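import Summits.QuantumFields.BalabanUV.T4Continuum.Support.NE3QuadRemainderGaugeStep
import HarnessLib

/-!
# Support | NE7 (gen 95, brick (S1)-B of memo WEIGHT-CURRENCY-DEAD §§7–9): ONE RESIDUAL GAUGE STEP IN DIFFERENCE FORM —
# `log(e^{a}e^{ρ}e^{−b}) = (a − b) + ρ + O(‖a−b‖·‖ρ‖ + ‖b‖·‖a−b‖ + ‖b‖·‖ρ‖)` (NO `‖a‖‖b‖`, NO `‖b‖²`), hence at a bond the gauge step `U ↦ U^{e^{μ}}` moves the relative
# field `X⁰` of `W·e^{X⁰}` to `X¹ = X⁰ + gaugeDir W μ + E` with `‖E‖ ≤ 16384‖gaugeDir W μ‖‖X⁰‖ + 2048‖μ(x+e_ν)‖‖gaugeDir W μ‖ + 6‖μ(x+e_ν)‖‖X⁰‖`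

Cell `pub-balaban`, rung (B)+1 sub-cell t4, lineage `b2b-balaban-t4-ne7-p1` (CRUX PROVER NE7 #1 = OWNER of row NE7), generation 95.  Over leaf-10's two-variable Schwarz lemma
`BlockAverageLogInteraction.norm_logK_one_one_le` (`‖log(e^{R−b}e^{b}) − R‖ ≤ 2048‖b‖‖R‖` — the DIFFERENCE FORM of BCH: with `R = a − b`, `b ↦ −b` it reads
`‖log(e^{a}e^{−b}) − (a − b)‖ ≤ 2048‖b‖‖a − b‖`) and γ23's symmetric letter `NE3QuadRemainderGaugeStep.norm_mlog_exp_mul_exp_sub_le` (`‖log(e^{A}e^{B}) − (A+B)‖ ≤ 4096‖A‖‖B‖`).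

WHY.  The supplier of the honest per-pair binder `hdecomp` (memo §7 (S1)) corrects gen 94's residual near-representative `u₀` by ONE residual gauge step `u₀·e^{μ}`, `μ` the corner
gauge of the linear split (F330 `NE7SliceLinearSplit.exists_linear_split`).  The κ-letter of `hdecomp` tolerates only a residue that is QUADRATICALLY small in the right variables: products
of the gauge DIRECTION `gaugeDir W μ` (not of the potential `μ` with itself — `μ` is as large as `M·sup‖X⁰‖`) with `μ` or `X⁰`, and of `μ` with `X⁰`.  γ23's ends-form (products of the
two end charges `‖μ(x)‖‖μ(x+e_ν)‖`) is the right currency for lacunary charges but NOT for a smooth `μ`; this file supplies the difference form.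
WHAT ([folklore]; 0 def, 0 sorry).  §1 **`norm_mlog_exp3_sub_diff_le`**: for `‖a‖, ‖b‖, ‖ρ‖ ≤ 1∕10000`,
`‖mlog(e^{a}e^{ρ}e^{−b}) − ((a − b) + ρ)‖ ≤ 16384‖a − b‖‖ρ‖ + 2048‖b‖‖a − b‖ + 6‖b‖‖ρ‖` (route: `e^{a}e^{ρ}e^{−b} = (e^{a}e^{−b})·(e^{b}e^{ρ}e^{−b})`, `logK` for the first factor,
conjugation for the second, the symmetric letter for the product).  §2 **`inv_mul_gaugeAct_expUnit_vary`** (the bond identity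
`W(b)⁻¹·(W·e^{X⁰})^{e^{μ}}(b) = e^{Ad_{W(b)⁻¹}μ(x)}·e^{X⁰(b)}·e^{−μ(x+e_ν)}`) and **`norm_gaugeStep_residue_le`** (THE BOND LETTER: `W` unitary, `‖μ‖ ≤ 1∕10000`, `‖X⁰‖ ≤ 1∕10000`:
`‖mlog(W(b)⁻¹(W·e^{X⁰})^{e^{μ}}(b)) − (X⁰(b) + gaugeDir W μ (b))‖ ≤ 16384‖gaugeDir W μ b‖‖X⁰ b‖ + 2048‖μ(x+e_ν)‖‖gaugeDir W μ b‖ + 6‖μ(x+e_ν)‖‖X⁰ b‖`),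
`gaugeAct_expUnit_vary_eq_vary_mlog` (the moved configuration is `W·e^{X¹}` with `X¹` that logarithm).
HONEST FRAMING (page 1): local matrix analysis at ONE bond; nothing multiscale, nothing of Bałaban's asserted; the energy bookkeeping of the residue and `hdecomp` are NOT here; NE7 NOT PROVED;
spine 0∕9; finite T⁴ rung (B)+1 — NOT infinite volume, NOT mass gap, NOT `BetaPertH`, NOT Clay.  Continuum YM on T⁴ ⇐ BetaPertH ∧ nine spine estimates (0/9 proved); BetaPertH ⇐ (D1) ∧ (D4)
∧ CAP+tail; G-an2-4 gates asym, D1 and NE2/3/4.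
-/

set_option autoImplicit false

open scoped BigOperators Matrix.Norms.L2Operator
open NormedSpace Finset

namespace Summit.QuantumFields.BalabanUV.T4Continuum.NE7GaugeStepResidue

open Literature.MathematicalPhysics.QuantumFieldTheory.Balaban1983to89
open B7Prop1Explicit B7Prop2Explicit MatrixLog UnitaryModel
open T4AveragingDeficitWall (IsUnitaryCfg IsSkewDir vary Ad)
open BlockAveragePushDirGauge (gaugeDir)
open BlockAverageLogInteraction (logK norm_logK_one_one_le norm_exp_sub_one_le_two_mul)
open NE3QuadRemainderGaugeStep (norm_mlog_exp_mul_exp_sub_le)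
open AveragingDeficitTransport (norm_Ad_of_unitary)

noncomputable section
variable {n : Type*} [Fintype n] [DecidableEq n]

/-! ## §1 The three-factor logarithm in difference form -/

/-- **BCH IN DIFFERENCE FORM**: `‖log(e^{a}e^{−b}) − (a − b)‖ ≤ 2048‖b‖‖a − b‖` for `‖b‖, ‖a − b‖ < 1∕32` (leaf-10's `logK` letter read at `(b, R) := (−b, a − b)`). [folklore] -/
theorem norm_mlog_exp_mul_exp_neg_sub_le [Nonempty n] {a b : Matrix n n ℂ} (hb : ‖b‖ < 1 / 32) (hab : ‖a - b‖ < 1 / 32) :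
    ‖mlog (exp a * exp (-b)) - (a - b)‖ ≤ 2048 * ‖b‖ * ‖a - b‖ := by
  have h := norm_logK_one_one_le (n := n) (b := -b) (R := a - b) (by rwa [norm_neg]) hab
  have e : logK (-b) (a - b) 1 1 = mlog (exp a * exp (-b)) - (a - b) := by
    unfold logK
    simp only [one_smul, sub_neg_eq_add, sub_add_cancel]
  rw [e, norm_neg] at h
  refine h.trans (le_of_eq ?_)
  ring

set_option maxHeartbeats 400000 in
/-- **THE THREE-FACTOR LOGARITHM IN DIFFERENCE FORM**: for `‖a‖, ‖b‖, ‖ρ‖ ≤ 1∕10000`,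
`‖mlog(e^{a}e^{ρ}e^{−b}) − ((a − b) + ρ)‖ ≤ 16384‖a − b‖‖ρ‖ + 2048‖b‖‖a − b‖ + 6‖b‖‖ρ‖` — no `‖a‖‖b‖` and no `‖b‖²` term. [folklore] -/
theorem norm_mlog_exp3_sub_diff_le [Nonempty n] {a b ρ : Matrix n n ℂ} (ha : ‖a‖ ≤ 1 / 10000) (hb : ‖b‖ ≤ 1 / 10000) (hρ : ‖ρ‖ ≤ 1 / 10000) :
    ‖mlog (exp a * exp ρ * exp (-b)) - ((a - b) + ρ)‖ ≤ 16384 * ‖a - b‖ * ‖ρ‖ + 2048 * ‖b‖ * ‖a - b‖ + 6 * ‖b‖ * ‖ρ‖ := by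
  have ha0 := norm_nonneg a
  have hb0 := norm_nonneg b
  have hρ0 := norm_nonneg ρ
  have hab : ‖a - b‖ ≤ 1 / 5000 := (norm_sub_le a b).trans (by linarith)
  have hab0 := norm_nonneg (a - b)
  -- (1) the first factor `P = e^{a}e^{−b}` and its logarithm `c`
  set P : Matrix n n ℂ := exp a * exp (-b) with hP
  have hea := norm_exp_sub_one_le_two_mul ha (by norm_num)
  have heb := norm_exp_sub_one_le_two_mul (Y := -b) (r := 1 / 10000) (by rwa [norm_neg]) (by norm_num)
  have hP1 : ‖P - 1‖ ≤ 1 / 2000 := by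
    have e : P - 1 = (exp a - 1) * exp (-b) + (exp (-b) - 1) := by rw [hP]; noncomm_ring
    rw [e]
    calc ‖(exp a - 1) * exp (-b) + (exp (-b) - 1)‖ ≤ ‖exp a - 1‖ * ‖exp (-b)‖ + ‖exp (-b) - 1‖ :=
          (norm_add_le _ _).trans (add_le_add (norm_mul_le _ _) le_rfl)
      _ ≤ (2 * (1 / 10000)) * (1 + 2 * (1 / 10000)) + 2 * (1 / 10000) :=
          add_le_add (mul_le_mul hea.1 heb.2 (norm_nonneg _) (by norm_num)) heb.1
      _ ≤ 1 / 2000 := by norm_num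
  set c : Matrix n n ℂ := mlog P with hc
  have hPc : exp c = P := exp_mlog (by linarith)
  have hcK : ‖c - (a - b)‖ ≤ 2048 * ‖b‖ * ‖a - b‖ :=
    norm_mlog_exp_mul_exp_neg_sub_le (by linarith) (by linarith)
  have hcn : ‖c‖ ≤ 2 * ‖a - b‖ := by
    have h1 : ‖c‖ ≤ ‖c - (a - b)‖ + ‖a - b‖ := by
      have := norm_add_le (c - (a - b)) (a - b); rwa [sub_add_cancel] at this
    nlinarith
  have hc100 : ‖c‖ ≤ 1 / 100 := by linarith
  -- (2) the conjugated middle factor `ρ' = e^{b} ρ e^{−b}`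
  set ρ' : Matrix n n ℂ := exp b * ρ * exp (-b) with hρ'
  have hebp := norm_exp_sub_one_le_two_mul hb (by norm_num)
  have hρ'ρ : ‖ρ' - ρ‖ ≤ 6 * ‖b‖ * ‖ρ‖ := by
    have e : ρ' - ρ = (exp b - 1) * ρ * exp (-b) + ρ * (exp (-b) - 1) := by
      rw [hρ']
      have h1 : exp b * exp (-b) = (1 : Matrix n n ℂ) := by
        have h := (expUnit b).mul_inv; rwa [val_inv_expUnit, val_expUnit, val_expUnit] at h
      noncomm_ring
    rw [e]
    have hb1 : ‖exp b - 1‖ ≤ 2 * ‖b‖ := (norm_exp_sub_one_le_two_mul (le_refl ‖b‖) (by linarith)).1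
    have hb2 : ‖exp (-b) - 1‖ ≤ 2 * ‖b‖ := (norm_exp_sub_one_le_two_mul (Y := -b) (r := ‖b‖) (by rw [norm_neg]) (by linarith)).1
    calc ‖(exp b - 1) * ρ * exp (-b) + ρ * (exp (-b) - 1)‖ ≤ ‖exp b - 1‖ * ‖ρ‖ * ‖exp (-b)‖ + ‖ρ‖ * ‖exp (-b) - 1‖ := by
          refine (norm_add_le _ _).trans (add_le_add ?_ (norm_mul_le _ _))
          exact (norm_mul_le _ _).trans (mul_le_mul_of_nonneg_right (norm_mul_le _ _) (norm_nonneg _))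
      _ ≤ (2 * ‖b‖) * ‖ρ‖ * (1 + 2 * (1 / 10000)) + ‖ρ‖ * (2 * ‖b‖) :=
          add_le_add (mul_le_mul (mul_le_mul_of_nonneg_right hb1 hρ0) heb.2 (norm_nonneg _) (by positivity))
            (mul_le_mul_of_nonneg_left hb2 hρ0)
      _ ≤ 6 * ‖b‖ * ‖ρ‖ := by nlinarith [mul_nonneg hb0 hρ0]
  have hρ'n : ‖ρ'‖ ≤ 2 * ‖ρ‖ := by
    have h1 : ‖ρ'‖ ≤ ‖ρ' - ρ‖ + ‖ρ‖ := by
      have := norm_add_le (ρ' - ρ) ρ; rwa [sub_add_cancel] at this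
    nlinarith [mul_nonneg hb0 hρ0]
  have hρ'100 : ‖ρ'‖ ≤ 1 / 100 := by linarith
  -- (3) the product identity `e^{a}e^{ρ}e^{−b} = P·e^{ρ'}` (`e^{ρ'} = e^{b}e^{ρ}e^{−b}`)
  have hexpρ' : exp ρ' = exp b * exp ρ * exp (-b) := by
    rw [hρ']
    letI : NormedAlgebra ℚ (Matrix n n ℂ) := NormedAlgebra.restrictScalars ℚ ℂ (Matrix n n ℂ)
    have h := exp_units_conj (expUnit b) ρ
    simp only [val_expUnit, val_inv_expUnit] at h
    exact h
  have hprod : exp a * exp ρ * exp (-b) = P * exp ρ' := by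
    rw [hexpρ', hP]
    have h1 : exp (-b) * exp b = (1 : Matrix n n ℂ) := by
      have h := (expUnit b).inv_mul; rwa [val_inv_expUnit, val_expUnit, val_expUnit] at h
    calc exp a * exp ρ * exp (-b) = exp a * (exp (-b) * exp b) * exp ρ * exp (-b) := by rw [h1, mul_one]
      _ = exp a * exp (-b) * (exp b * exp ρ * exp (-b)) := by noncomm_ring
  -- (4) the symmetric letter for `log(e^{c}e^{ρ'})`
  have hsym := norm_mlog_exp_mul_exp_sub_le hc100 hρ'100
  rw [hprod, ← hPc]
  have e : mlog (exp c * exp ρ') - ((a - b) + ρ) = (mlog (exp c * exp ρ') - (c + ρ')) + (c - (a - b)) + (ρ' - ρ) := by abel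
  rw [e]
  calc ‖(mlog (exp c * exp ρ') - (c + ρ')) + (c - (a - b)) + (ρ' - ρ)‖
      ≤ ‖mlog (exp c * exp ρ') - (c + ρ')‖ + ‖c - (a - b)‖ + ‖ρ' - ρ‖ := norm_add₃_le
    _ ≤ 4096 * ‖c‖ * ‖ρ'‖ + 2048 * ‖b‖ * ‖a - b‖ + 6 * ‖b‖ * ‖ρ‖ := add_le_add (add_le_add hsym hcK) hρ'ρ
    _ ≤ 16384 * ‖a - b‖ * ‖ρ‖ + 2048 * ‖b‖ * ‖a - b‖ + 6 * ‖b‖ * ‖ρ‖ := by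
        nlinarith [mul_le_mul hcn hρ'n (norm_nonneg _) (by positivity), norm_nonneg c, norm_nonneg ρ']

/-! ## §2 One residual gauge step at a bond -/

variable {d : ℕ}

/-- **THE BOND IDENTITY OF A GAUGE STEP**: `W(b)⁻¹·(W·e^{X⁰})^{e^{μ}}(b) = e^{Ad_{W(b)⁻¹}μ(x)}·e^{X⁰(b)}·e^{−μ(x+e_ν)}`. [folklore] -/
theorem inv_mul_gaugeAct_expUnit_vary (W : Site d → Fin d → (Matrix n n ℂ)ˣ) (μ : Site d → Matrix n n ℂ) (X : Site d → Fin d → Matrix n n ℂ)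
    (x : Site d) (ν : Fin d) :
    (((W x ν)⁻¹ : (Matrix n n ℂ)ˣ) : Matrix n n ℂ) * ((gaugeAct (fun y => expUnit (μ y)) (vary W X 1) x ν : (Matrix n n ℂ)ˣ) : Matrix n n ℂ)
      = exp (Ad (W x ν)⁻¹ (μ x)) * exp (X x ν) * exp (-(μ (x + e ν))) := by
  have hconj : exp (Ad (W x ν)⁻¹ (μ x)) = (((W x ν)⁻¹ : (Matrix n n ℂ)ˣ) : Matrix n n ℂ) * exp (μ x) * ((W x ν : (Matrix n n ℂ)ˣ) : Matrix n n ℂ) := by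
    letI : NormedAlgebra ℚ (Matrix n n ℂ) := NormedAlgebra.restrictScalars ℚ ℂ (Matrix n n ℂ)
    have h := exp_units_conj ((W x ν)⁻¹) (μ x)
    simp only [inv_inv] at h
    exact h
  rw [hconj]
  simp only [gaugeAct, vary, Units.val_mul, val_expUnit, val_inv_expUnit, one_smul, Complex.ofReal_one]
  noncomm_ring

/-- **THE BOND LETTER OF ONE RESIDUAL GAUGE STEP, DIFFERENCE FORM**: for `W` unitary, `‖μ‖ ≤ 1∕10000` at the two ends of the bond and `‖X⁰(b)‖ ≤ 1∕10000`,
`‖mlog(W(b)⁻¹(W·e^{X⁰})^{e^{μ}}(b)) − (X⁰(b) + gaugeDir W μ (b))‖ ≤ 16384‖gaugeDir W μ b‖‖X⁰ b‖ + 2048‖μ(x+e_ν)‖‖gaugeDir W μ b‖ + 6‖μ(x+e_ν)‖‖X⁰ b‖`. [folklore] -/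
theorem norm_gaugeStep_residue_le [Nonempty n] {W : Site d → Fin d → (Matrix n n ℂ)ˣ} (hW : IsUnitaryCfg W) {μ : Site d → Matrix n n ℂ}
    {X : Site d → Fin d → Matrix n n ℂ} (x : Site d) (ν : Fin d) (hμx : ‖μ x‖ ≤ 1 / 10000) (hμy : ‖μ (x + e ν)‖ ≤ 1 / 10000) (hX : ‖X x ν‖ ≤ 1 / 10000) :
    ‖mlog ((((W x ν)⁻¹ : (Matrix n n ℂ)ˣ) : Matrix n n ℂ) * ((gaugeAct (fun y => expUnit (μ y)) (vary W X 1) x ν : (Matrix n n ℂ)ˣ) : Matrix n n ℂ))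
        - (X x ν + gaugeDir W μ x ν)‖
      ≤ 16384 * ‖gaugeDir W μ x ν‖ * ‖X x ν‖ + 2048 * ‖μ (x + e ν)‖ * ‖gaugeDir W μ x ν‖ + 6 * ‖μ (x + e ν)‖ * ‖X x ν‖ := by
  rw [inv_mul_gaugeAct_expUnit_vary]
  have hu : (W x ν)⁻¹ ∈ unitaryUnits (Matrix n n ℂ) := (unitaryUnits (Matrix n n ℂ)).inv_mem (hW x ν)
  have ha : ‖Ad (W x ν)⁻¹ (μ x)‖ ≤ 1 / 10000 := by rw [norm_Ad_of_unitary hu]; exact hμx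
  have h := norm_mlog_exp3_sub_diff_le ha hμy hX
  have e : Ad (W x ν)⁻¹ (μ x) - μ (x + e ν) = gaugeDir W μ x ν := rfl
  rw [e] at h
  have e2 : gaugeDir W μ x ν + X x ν = X x ν + gaugeDir W μ x ν := add_comm _ _
  rw [e2] at h
  exact h

/-- **THE MOVED CONFIGURATION IN THE CHART**: under the same smallness, `(W·e^{X⁰})^{e^{μ}} = W·e^{X¹}` with `X¹(b) := mlog(W(b)⁻¹(W·e^{X⁰})^{e^{μ}}(b))`. [folklore] -/
theorem gaugeAct_expUnit_vary_eq_vary_mlog [Nonempty n] {W : Site d → Fin d → (Matrix n n ℂ)ˣ} (hW : IsUnitaryCfg W) {μ : Site d → Matrix n n ℂ}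
    {X : Site d → Fin d → Matrix n n ℂ} (hμ : ∀ y, ‖μ y‖ ≤ 1 / 10000) (hX : ∀ y κ, ‖X y κ‖ ≤ 1 / 10000) :
    gaugeAct (fun y => expUnit (μ y)) (vary W X 1)
      = vary W (fun y κ => mlog ((((W y κ)⁻¹ : (Matrix n n ℂ)ˣ) : Matrix n n ℂ)
          * ((gaugeAct (fun y => expUnit (μ y)) (vary W X 1) y κ : (Matrix n n ℂ)ˣ) : Matrix n n ℂ))) 1 := by
  funext y κ
  apply Units.ext
  have hu : (W y κ)⁻¹ ∈ unitaryUnits (Matrix n n ℂ) := (unitaryUnits (Matrix n n ℂ)).inv_mem (hW y κ)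
  -- the relative unit is in the ball of `mlog`
  have hball : ‖(((W y κ)⁻¹ : (Matrix n n ℂ)ˣ) : Matrix n n ℂ) * ((gaugeAct (fun y => expUnit (μ y)) (vary W X 1) y κ : (Matrix n n ℂ)ˣ) : Matrix n n ℂ) - 1‖ < 1 := by
    rw [inv_mul_gaugeAct_expUnit_vary]
    have ha : ‖Ad (W y κ)⁻¹ (μ y)‖ ≤ 1 / 10000 := by rw [norm_Ad_of_unitary hu]; exact hμ y
    have h1 := norm_exp_sub_one_le_two_mul ha (by norm_num)
    have h2 := norm_exp_sub_one_le_two_mul (hX y κ) (by norm_num)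
    have h3 := norm_exp_sub_one_le_two_mul (Y := -(μ (y + e κ))) (r := 1 / 10000) (by rw [norm_neg]; exact hμ _) (by norm_num)
    have h := BlockAverageLogInteraction.norm_mul3_sub_one_le h1.1 h2.1 h3.1
    refine lt_of_le_of_lt h ?_
    norm_num
  simp only [vary, Units.val_mul, val_expUnit, one_smul, Complex.ofReal_one]
  rw [exp_mlog hball, ← mul_assoc, Units.mul_inv, one_mul]

end

end Summit.QuantumFields.BalabanUV.T4Continuum.NE7GaugeStepResidue
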